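import Summits.Langlands.Langlands.Theses.IrreducibilityBySelfDuality
import Literature.NumberTheory.Automorphic.ArchParameterTwistNorm
import Literature.NumberTheory.Automorphic.AutomorphicTwistNorm
import Literature.NumberTheory.Automorphic.IdeleNormDetGL
import Literature.NumberTheory.Automorphic.AutomorphicRepsGLOneArchParameter
import Literature.NumberTheory.Automorphic.GLOneOfHeckeCharacterBJ
import Literature.NumberTheory.Automorphic.GLnAdelicStructureProofs

/-!
# `RegularAdjointLiftCM` — negative lane: the real shift of `stub_hermitianSymmetry` is unconstrained

Refuter-side (drefute, gen 2) support for the crux `RegularAdjointLiftCM` (item stmt-Langlands-13617,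
route `route-Langlands-IrreducibilityBySelfDuality`), line `nu-cubed-central-character`
(`Cruxes/RegularAdjointLiftCM/Lines/nu-cubed-central-character.lean`), whose last open stub reads

  `stub_hermitianSymmetry : ∀ n [NeZero n] K hcpt (π cuspidal on GL_n) χ, π.1.HasArchParameter χ →
     ∃ c : ℝ, ∀ ι, χ(ῑ) = (χ ι).map (a ↦ -ā + c)`.

No statement of the route is proved or refuted here.  The file records, kernel-checked, what the
cheap attacks on this stub establish (the same statement is the sibling crux `RegularTwistCM`'s
`UnitaryMirror` / `HermitianArchSymmetryCuspidal`, so everything below serves both cruxes):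

* `eq_univ_of_shiftLaw_glOne_rat` — **the real shift `c` is COMPLETELY unconstrained**: if a set
  `S ⊆ ℝ` contains, for every cuspidal `GL₁` datum over `ℚ` with an archimedean parameter, an
  admissible shift, then `S = ℝ`.  Witness family: the Borel–Jacquet line of the trivial Hecke
  character and its twists by `‖·‖^s`, `s ∈ ℝ` (`exists_heckeCharacter_ideleNorm_cpow`,
  `exists_cuspidalAutomorphicRepData_map_mulChar_detTwist`), whose parameters are `χ₀ + s`
  (`AutomorphicRepData.HasArchParameter.of_map_mulChar_detTwist`) and whose shift is therefore pinned to
  `c₀ + 2s` (`shiftLaw_of_mirror_shifted`).  Hence (`not_hermitianShiftIn_of_ne_univ`) EVERY strengthening of the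
  stub of the form "`∃ c ∈ S`" with `S ≠ ℝ` is false: `c = 0` (the cycle-3 Disproof's
  `not_hermitianSymmetryZero`, re-derived), `c ∈ ℤ`, `2c ∈ ℤ` (what Clozel purity gives for REGULAR
  ALGEBRAIC types — so integrality of `c` is a consequence of algebraicity, never of cuspidality),
  `c ∈ ℚ`, `c ≥ 0`, `c ≤ 0`.
* `shiftLaw_rank_zero`, `shiftLaw_iff_withoutNeZero` — the instance hypothesis `[NeZero n]` is
  decoration: at `n = 0` every parameter is empty and the conclusion holds for every `c`.
* `conj_eq_of_shiftLaw`, `shiftLaw_iff_complexShift` — typing the shift as a REAL number loses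
  nothing: a complex shift `c` satisfying the mirror relation at `ι` and at `ῑ` for one non-empty
  `χ ι` is real (`χ ι` would be invariant under translation by `c - c̄`).

(The `n = 1` case of the stub itself is the tree theorem
`Summit.Langlands.Langlands.Theorems.RegularTwistCM.Negative.unitaryMirror_one`; the content of the
stub is `n ≥ 2`.)
-/

open scoped BigOperators ComplexConjugate Classical
open NumberField
open Literature.NumberTheory.Automorphic
open Literature.NumberTheory.GaloisRepresentations (HeckeCharacter ideleGroup)

set_option linter.dupNamespace false

noncomputable section

namespace Summit.Langlands.Langlands.Theorems.RegularAdjointLiftCM.Negative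

/-! ### Multiset bookkeeping -/

/-- `Σ (a + d) = Σ a + |s| d`. [folklore] -/
theorem shiftLaw_sum_map_add (s : Multiset ℂ) (d : ℂ) :
    (s.map fun a => a + d).sum = s.sum + Multiset.card s * d := by
  induction s using Multiset.induction_on with
  | empty => simp
  | cons a s ih =>
      rw [Multiset.map_cons, Multiset.sum_cons, Multiset.sum_cons, ih, Multiset.card_cons]
      push_cast
      ring

/-- `Σ (-conj(a + d) + c) = -conj(Σ a) + |s| (c - conj d)`. [folklore] -/
theorem shiftLaw_sum_map_negConj (s : Multiset ℂ) (d c : ℂ) :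
    (s.map fun a => -(starRingEnd ℂ (a + d)) + c).sum =
      -(starRingEnd ℂ s.sum) + Multiset.card s * (c - starRingEnd ℂ d) := by
  induction s using Multiset.induction_on with
  | empty => simp
  | cons a s ih =>
      rw [Multiset.map_cons, Multiset.sum_cons, Multiset.sum_cons, ih, Multiset.card_cons, map_add,
        map_add]
      push_cast
      ring

/-- `Σ (-conj(-conj a + c) + c) = Σ a + |s| (c - conj c)`: the mirror map `a ↦ -ā + c` applied twice
is the translation by `c - c̄`. [folklore] -/
theorem shiftLaw_sum_map_mirror_mirror (s : Multiset ℂ) (c : ℂ) :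
    (s.map fun a => -(starRingEnd ℂ (-(starRingEnd ℂ a) + c)) + c).sum =
      s.sum + Multiset.card s * (c - starRingEnd ℂ c) := by
  induction s using Multiset.induction_on with
  | empty => simp
  | cons a s ih =>
      rw [Multiset.map_cons, Multiset.sum_cons, Multiset.sum_cons, ih, Multiset.card_cons, map_add,
        map_neg, Complex.conj_conj]
      push_cast
      ring

/-! ### An archimedean parameter on `GL_n` has `n` entries at every embedding -/

section Card

variable {n : ℕ} {K : Type} [Field K] [NumberField K] {hcpt : isCompact_glFiniteIntegralLevel n K}

/-- An archimedean parameter of a datum on `GL_n(𝔸_K)` has `n` entries at every complex embedding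
(re-proof of the tree's `AutomorphicRepData.card_eq_of_hasArchParameter`, kept import-light: `σ` is
`w.embedding` or its conjugate for `w = mk σ`, and `card_eq_of_hasHCParameter`). [cite: Clozel1990, §3.3] -/
theorem shiftLaw_card_eq {π : AutomorphicRepData (AutomorphyDatum.gl n K hcpt)}
    {χ : (K →+* ℂ) → Multiset ℂ} (h : π.HasArchParameter χ) (σ : K →+* ℂ) :
    Multiset.card (χ σ) = n := by
  obtain ⟨ρ, -, hre, hco⟩ := h
  rcases (InfinitePlace.mk σ).isReal_or_isComplex with hw | hw
  · have h1 := (hre ⟨InfinitePlace.mk σ, hw⟩).1 (Algebra.ofId ℝ ℂ)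
    dsimp only at h1
    rwa [InfinitePlace.embedding_mk_eq_of_isReal (InfinitePlace.isReal_mk_iff.mp hw)] at h1
  · rcases InfinitePlace.mk_eq_iff.mp (InfinitePlace.mk_embedding (InfinitePlace.mk σ)) with hσ | hσ
    · have h1 := (hco ⟨InfinitePlace.mk σ, hw⟩).1 (AlgHom.id ℝ ℂ)
      dsimp only at h1
      rwa [algHomId_toRingHom_comp, hσ] at h1
    · have h1 := (hco ⟨InfinitePlace.mk σ, hw⟩).1 (Complex.conjAe : ℂ →ₐ[ℝ] ℂ)
      dsimp only at h1
      rwa [conjAe_toRingHom_comp, hσ] at h1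

end Card

/-! ### The shift law under norm twists, and the unconstrained shift -/

/-- **The shift law under `⊗ ‖det‖^s` on `GL₁`.**  If a `GL₁` datum `π` over `K` has parameter `χ₀`
and the shifted parameter `χ₀ + s` (`s` real: the parameter of the twist `π ⊗ ‖det‖^s`,
`AutomorphicRepData.HasArchParameter.of_map_mulChar_detTwist`) obeys the mirror relation at `ι` with
shift `c`, then `c = Σ χ₀(ῑ) + conj Σ χ₀(ι) + 2s` — the admissible shift moves by `2s` under a twist by
`‖·‖^s` (only `card χ₀(ι) = card χ₀(ῑ) = 1` is used). [folklore] -/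
theorem shiftLaw_of_mirror_shifted {K : Type} [Field K] [NumberField K]
    {hcpt : isCompact_glFiniteIntegralLevel 1 K} {π : CuspidalAutomorphicRepData 1 K hcpt}
    {χ₀ : (K →+* ℂ) → Multiset ℂ} (hχ₀ : π.1.HasArchParameter χ₀) {s c : ℝ} {ι : K →+* ℂ}
    (hc : (fun σ => (χ₀ σ).map (· + (s : ℂ))) (ComplexEmbedding.conjugate ι) =
      ((fun σ => (χ₀ σ).map (· + (s : ℂ))) ι).map fun a => -(starRingEnd ℂ a) + (c : ℂ)) :
    (c : ℂ) = (χ₀ (ComplexEmbedding.conjugate ι)).sum + starRingEnd ℂ (χ₀ ι).sum + 2 * (s : ℂ) := by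
  have hcard₁ : Multiset.card (χ₀ ι) = 1 := shiftLaw_card_eq hχ₀ ι
  have hcard₂ : Multiset.card (χ₀ (ComplexEmbedding.conjugate ι)) = 1 := shiftLaw_card_eq hχ₀ _
  have e := congrArg Multiset.sum hc
  simp only [Multiset.map_map, Function.comp_def] at e
  rw [shiftLaw_sum_map_add, shiftLaw_sum_map_negConj, hcard₁, hcard₂, Complex.conj_ofReal] at e
  push_cast at e
  linear_combination -e

/-- **The real shift of the stub is completely unconstrained — already on `GL₁` over `ℚ`.**  If
`S ⊆ ℝ` contains an admissible shift for every cuspidal `GL₁` datum over `ℚ` having an archimedean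
parameter, then `S = ℝ`: the line of the trivial Hecke character (`exists_automorphicRepData_detTwist_glOne`)
has a parameter `χ₀` (`exists_hasArchParameter_glOne`), its twist by `‖·‖^s` has parameter `χ₀ + s`, and by
`shiftLaw_of_mirror_shifted` the admissible shift of the twist is EXACTLY `c₀ + 2s` with `c₀` the shift of the line
itself; `s` ranges over `ℝ`. [folklore] -/
theorem eq_univ_of_shiftLaw_glOne_rat {S : Set ℝ}
    (h : ∀ (hcpt : isCompact_glFiniteIntegralLevel 1 ℚ) (π : CuspidalAutomorphicRepData 1 ℚ hcpt)
      (χ : (ℚ →+* ℂ) → Multiset ℂ), π.1.HasArchParameter χ →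
        ∃ c ∈ S, ∀ ι : ℚ →+* ℂ,
          χ (ComplexEmbedding.conjugate ι) = (χ ι).map fun a => -(starRingEnd ℂ a) + (c : ℂ)) :
    S = Set.univ := by
  have h1 : isCompact_glFiniteIntegralLevel 1 ℚ := isCompact_glFiniteIntegralLevel_holds 1 ℚ
  -- the Borel–Jacquet line of the trivial Hecke character, a cuspidal `GL₁` datum
  obtain ⟨τ₀, hW₀, -⟩ := exists_automorphicRepData_detTwist_glOne h1 (1 : HeckeCharacter ℚ)
  have hcusp : τ₀.W ≤ cuspFormsGL 1 ℚ h1 := by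
    rw [hW₀, Submodule.span_le]
    rintro _ rfl
    exact IsCuspFormGL.mem_cuspFormsGL
      ⟨isAutomorphicForm_detTwist_glOne h1 1, fun k hk hk1 => absurd hk1 (by omega)⟩
  set τ : CuspidalAutomorphicRepData 1 ℚ h1 := ⟨τ₀, hcusp⟩
  obtain ⟨χ₀, hχ₀⟩ : ∃ χ : (ℚ →+* ℂ) → Multiset ℂ, τ.1.HasArchParameter χ :=
    τ₀.exists_hasArchParameter_glOne
  set ι : ℚ →+* ℂ := Rat.castHom ℂ
  set A : ℂ := (χ₀ (ComplexEmbedding.conjugate ι)).sum + starRingEnd ℂ (χ₀ ι).sum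
  -- for every real `s`, the twist `τ ⊗ ‖·‖^s` forces `A + 2s ∈ S`
  have key : ∀ s : ℝ, ∃ c ∈ S, (c : ℂ) = A + 2 * (s : ℂ) := by
    intro s
    obtain ⟨μ, hμ⟩ := exists_heckeCharacter_ideleNorm_cpow (K := ℚ) ((s : ℝ) : ℂ)
    obtain ⟨τ', hW, hW'⟩ := exists_cuspidalAutomorphicRepData_map_mulChar_detTwist hμ τ
    obtain ⟨c, hcS, hc⟩ := h h1 τ' _
      (AutomorphicRepData.HasArchParameter.of_map_mulChar_detTwist hμ hW hW' hχ₀)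
    exact ⟨c, hcS, shiftLaw_of_mirror_shifted hχ₀ (hc ι)⟩
  ext t
  simp only [Set.mem_univ, iff_true]
  obtain ⟨c₁, -, hc₁⟩ := key 0
  obtain ⟨c₂, hc₂S, hc₂⟩ := key ((t - c₁) / 2)
  have e : (c₂ : ℂ) = (t : ℂ) := by
    rw [hc₂]
    push_cast at hc₁ ⊢
    linear_combination -hc₁
  rwa [← Complex.ofReal_injective e]

/-! ### The stub with a constrained shift -/

/-- The stub `stub_hermitianSymmetry` with its real shift constrained to lie in `S ⊆ ℝ`
(`S = univ` is the stub verbatim, `hermitianShiftIn_univ_iff`); by `eq_univ_of_hermitianShiftIn` it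
holds ONLY for `S = univ`. [folklore] -/
def HermitianShiftIn (S : Set ℝ) : Prop :=
  ∀ (n : ℕ) [NeZero n] (K : Type) [Field K] [NumberField K] (hcpt : isCompact_glFiniteIntegralLevel n K)
    (π : CuspidalAutomorphicRepData n K hcpt) (χ : (K →+* ℂ) → Multiset ℂ), π.1.HasArchParameter χ →
      ∃ c ∈ S, ∀ ι : K →+* ℂ,
        χ (ComplexEmbedding.conjugate ι) = (χ ι).map fun a => -(starRingEnd ℂ a) + (c : ℂ)

/-- `HermitianShiftIn univ` is the stub `stub_hermitianSymmetry` VERBATIM. [folklore] -/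
theorem hermitianShiftIn_univ_iff :
    HermitianShiftIn Set.univ ↔
      ∀ (n : ℕ) [NeZero n] (K : Type) [Field K] [NumberField K]
        (hcpt : isCompact_glFiniteIntegralLevel n K) (π : CuspidalAutomorphicRepData n K hcpt)
        (χ : (K →+* ℂ) → Multiset ℂ), π.1.HasArchParameter χ →
          ∃ c : ℝ, ∀ ι : K →+* ℂ,
            χ (ComplexEmbedding.conjugate ι) = (χ ι).map fun a => -(starRingEnd ℂ a) + (c : ℂ) := by
  constructor
  · intro h n _ K _ _ hcpt π χ hχ
    obtain ⟨c, -, hc⟩ := h n K hcpt π χ hχ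
    exact ⟨c, hc⟩
  · intro h n _ K _ _ hcpt π χ hχ
    obtain ⟨c, hc⟩ := h n K hcpt π χ hχ
    exact ⟨c, Set.mem_univ c, hc⟩

/-- **Any shift-constrained form of the stub forces `S = ℝ`.** [folklore] -/
theorem eq_univ_of_hermitianShiftIn {S : Set ℝ} (h : HermitianShiftIn S) : S = Set.univ :=
  haveI : NeZero (1 : ℕ) := ⟨one_ne_zero⟩
  eq_univ_of_shiftLaw_glOne_rat fun hcpt π χ hχ => h 1 ℚ hcpt π χ hχ

/-- Hence every strengthening "`∃ c ∈ S`" of the stub with `S ≠ ℝ` is FALSE. [folklore] -/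
theorem not_hermitianShiftIn_of_ne_univ {S : Set ℝ} (hS : S ≠ Set.univ) : ¬ HermitianShiftIn S :=
  fun h => hS (eq_univ_of_hermitianShiftIn h)

/-- `c = 0` ("the parameter itself is Hermitian-symmetric", true for UNITARY `π_∞`) is false for
cuspidal Borel–Jacquet data (no `A_G`-normalisation): re-derivation of the cycle-3 Disproof's
`not_hermitianSymmetryZero`. [folklore] -/
theorem not_hermitianShiftIn_zero : ¬ HermitianShiftIn {0} :=
  not_hermitianShiftIn_of_ne_univ fun h => by
    have h1 : (1 : ℝ) ∈ ({0} : Set ℝ) := h ▸ Set.mem_univ 1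
    norm_num at h1

/-- `c ∈ ℤ` is false (it holds for regular algebraic types by integrality of the exponents — the glue
`purityGL3_of_hermitianSymmetry` of the line — but not for cuspidal data in general). [folklore] -/
theorem not_hermitianShiftIn_int : ¬ HermitianShiftIn (Set.range ((↑) : ℤ → ℝ)) :=
  not_hermitianShiftIn_of_ne_univ fun h => by
    have h1 : (1 / 2 : ℝ) ∈ Set.range ((↑) : ℤ → ℝ) := h ▸ Set.mem_univ _
    obtain ⟨m, hm⟩ := h1
    have h2 : (2 : ℝ) * m = 1 := by rw [hm]; norm_num
    have h3 : (2 : ℤ) * m = 1 := by exact_mod_cast h2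
    omega

/-- `2c ∈ ℤ` (Clozel's weight for C-algebraic types) is false for cuspidal data in general. [folklore] -/
theorem not_hermitianShiftIn_halfInt : ¬ HermitianShiftIn {c | ∃ m : ℤ, 2 * c = m} :=
  not_hermitianShiftIn_of_ne_univ fun h => by
    have h1 : (1 / 4 : ℝ) ∈ {c : ℝ | ∃ m : ℤ, 2 * c = m} := h ▸ Set.mem_univ _
    obtain ⟨m, hm⟩ := h1
    have h2 : (2 : ℝ) * m = 1 := by rw [← hm]; norm_num
    have h3 : (2 : ℤ) * m = 1 := by exact_mod_cast h2
    omega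

/-- `c ∈ ℚ` is false (`√2` is irrational). [folklore] -/
theorem not_hermitianShiftIn_rat : ¬ HermitianShiftIn (Set.range ((↑) : ℚ → ℝ)) :=
  not_hermitianShiftIn_of_ne_univ fun h => irrational_sqrt_two (h ▸ Set.mem_univ _)

/-- The SIGN of `c` is not determined either: `c ≥ 0` is false … [folklore] -/
theorem not_hermitianShiftIn_nonneg : ¬ HermitianShiftIn (Set.Ici 0) :=
  not_hermitianShiftIn_of_ne_univ fun h => by
    have h1 : (-1 : ℝ) ∈ Set.Ici (0 : ℝ) := h ▸ Set.mem_univ _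
    norm_num at h1

/-- … and so is `c ≤ 0`. [folklore] -/
theorem not_hermitianShiftIn_nonpos : ¬ HermitianShiftIn (Set.Iic 0) :=
  not_hermitianShiftIn_of_ne_univ fun h => by
    have h1 : (1 : ℝ) ∈ Set.Iic (0 : ℝ) := h ▸ Set.mem_univ _
    norm_num at h1

/-! ### `[NeZero n]` is decoration -/

/-- **Rank zero is trivial**: a datum on `GL₀` has the empty parameter at every embedding, so the mirror
relation holds for EVERY shift `c`. [folklore] -/
theorem shiftLaw_rank_zero (K : Type) [Field K] [NumberField K] (hcpt : isCompact_glFiniteIntegralLevel 0 K)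
    (π : CuspidalAutomorphicRepData 0 K hcpt) (χ : (K →+* ℂ) → Multiset ℂ) (hχ : π.1.HasArchParameter χ)
    (c : ℝ) (ι : K →+* ℂ) :
    χ (ComplexEmbedding.conjugate ι) = (χ ι).map fun a => -(starRingEnd ℂ a) + (c : ℂ) := by
  have h1 : χ (ComplexEmbedding.conjugate ι) = 0 := Multiset.card_eq_zero.mp (shiftLaw_card_eq hχ _)
  have h2 : χ ι = 0 := Multiset.card_eq_zero.mp (shiftLaw_card_eq hχ _)
  rw [h1, h2, Multiset.map_zero]

/-- Hence the stub with `[NeZero n]` deleted is EQUIVALENT to the stub. [folklore] -/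
theorem shiftLaw_iff_withoutNeZero :
    (∀ (n : ℕ) [NeZero n] (K : Type) [Field K] [NumberField K]
        (hcpt : isCompact_glFiniteIntegralLevel n K) (π : CuspidalAutomorphicRepData n K hcpt)
        (χ : (K →+* ℂ) → Multiset ℂ), π.1.HasArchParameter χ →
          ∃ c : ℝ, ∀ ι : K →+* ℂ,
            χ (ComplexEmbedding.conjugate ι) = (χ ι).map fun a => -(starRingEnd ℂ a) + (c : ℂ)) ↔
    (∀ (n : ℕ) (K : Type) [Field K] [NumberField K]
        (hcpt : isCompact_glFiniteIntegralLevel n K) (π : CuspidalAutomorphicRepData n K hcpt)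
        (χ : (K →+* ℂ) → Multiset ℂ), π.1.HasArchParameter χ →
          ∃ c : ℝ, ∀ ι : K →+* ℂ,
            χ (ComplexEmbedding.conjugate ι) = (χ ι).map fun a => -(starRingEnd ℂ a) + (c : ℂ)) := by
  constructor
  · intro h n K _ _ hcpt π χ hχ
    rcases Nat.eq_zero_or_pos n with rfl | hn
    · exact ⟨0, shiftLaw_rank_zero K hcpt π χ hχ 0⟩
    · haveI : NeZero n := NeZero.of_pos hn
      exact h n K hcpt π χ hχ
  · intro h n _ K _ _ hcpt π χ hχ
    exact h n K hcpt π χ hχ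

/-! ### A complex shift is automatically real -/

/-- **A complex shift obeying the mirror relation at `ι` and at `ῑ` is real** as soon as `χ ι ≠ 0`:
applying `a ↦ -ā + c` twice translates `χ ι` by `c - c̄`, and a non-empty finite multiset is not
invariant under a non-zero translation (compare sums). [folklore] -/
theorem conj_eq_of_shiftLaw {K : Type} [Field K] (χ : (K →+* ℂ) → Multiset ℂ) (c : ℂ)
    (h : ∀ ι : K →+* ℂ, χ (ComplexEmbedding.conjugate ι) = (χ ι).map fun a => -(starRingEnd ℂ a) + c)
    {ι : K →+* ℂ} (hne : χ ι ≠ 0) : starRingEnd ℂ c = c := by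
  have h1 := h (ComplexEmbedding.conjugate ι)
  rw [show ComplexEmbedding.conjugate (ComplexEmbedding.conjugate ι) = ι from star_star ι, h ι,
    Multiset.map_map] at h1
  have e := congrArg Multiset.sum h1
  simp only [Function.comp_def] at e
  rw [shiftLaw_sum_map_mirror_mirror] at e
  have hcard : (Multiset.card (χ ι) : ℂ) ≠ 0 :=
    Nat.cast_ne_zero.mpr fun h0 => hne (Multiset.card_eq_zero.mp h0)
  have e2 : (Multiset.card (χ ι) : ℂ) * (c - starRingEnd ℂ c) = 0 := by linear_combination -e
  rcases mul_eq_zero.mp e2 with h0 | h0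
  · exact absurd h0 hcard
  · exact (sub_eq_zero.mp h0).symm

/-- Hence the stub with a COMPLEX shift `c : ℂ` is EQUIVALENT to the stub (real `c`): for `n ≥ 1` the
parameter at any embedding is non-empty. [folklore] -/
theorem shiftLaw_iff_complexShift :
    (∀ (n : ℕ) [NeZero n] (K : Type) [Field K] [NumberField K]
        (hcpt : isCompact_glFiniteIntegralLevel n K) (π : CuspidalAutomorphicRepData n K hcpt)
        (χ : (K →+* ℂ) → Multiset ℂ), π.1.HasArchParameter χ →
          ∃ c : ℝ, ∀ ι : K →+* ℂ,
            χ (ComplexEmbedding.conjugate ι) = (χ ι).map fun a => -(starRingEnd ℂ a) + (c : ℂ)) ↔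
    (∀ (n : ℕ) [NeZero n] (K : Type) [Field K] [NumberField K]
        (hcpt : isCompact_glFiniteIntegralLevel n K) (π : CuspidalAutomorphicRepData n K hcpt)
        (χ : (K →+* ℂ) → Multiset ℂ), π.1.HasArchParameter χ →
          ∃ c : ℂ, ∀ ι : K →+* ℂ,
            χ (ComplexEmbedding.conjugate ι) = (χ ι).map fun a => -(starRingEnd ℂ a) + c) := by
  constructor
  · intro h n _ K _ _ hcpt π χ hχ
    obtain ⟨c, hc⟩ := h n K hcpt π χ hχ
    exact ⟨c, hc⟩
  · intro h n _ K _ _ hcpt π χ hχ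
    obtain ⟨c, hc⟩ := h n K hcpt π χ hχ
    set ι₀ : K →+* ℂ := (Classical.arbitrary (InfinitePlace K)).embedding
    have hne : χ ι₀ ≠ 0 := fun h0 => by
      have h1 := shiftLaw_card_eq hχ ι₀
      rw [h0, Multiset.card_zero] at h1
      exact NeZero.ne n h1.symm
    have hreal : (c.re : ℂ) = c := Complex.conj_eq_iff_re.mp (conj_eq_of_shiftLaw χ c hc hne)
    exact ⟨c.re, fun ι => by rw [hreal]; exact hc ι⟩

end Summit.Langlands.Langlands.Theorems.RegularAdjointLiftCM.Negative

end
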